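import Literature.AlgebraicGeometry.Frobenioids.UnitTrivializationProofs
import Literature.AlgebraicGeometry.Frobenioids.UnitEquivalenceProofs
import HarnessLib

/-!
# Frobenioids I, Proposition 3.3 (iii), (iv) for Frobenioids — the closed forms

Mochizuki, *The geometry of Frobenioids I: the general theory*, Kyushu J. Math. **62** (2008),
kurims text p. 60 [cite: MochizukiFrdI2008, Prop. 3.3 (iii)(iv) p.60]. Proof-only: combines
`UnitTrivializationProofs.lean` (Prop. 3.3 (iii) for every `PreFrobenioidData`; (iv) from (ii)) with the
discharged named fact `FrdI.Prop33ii_holds` (`UnitEquivalenceProofs.lean`, seat abc-iut-L1-t13) to give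
Prop. 3.3 (iv) AS TYPED (`Prop33iv`, `BaseCategoryTheoreticityDefs.lean`, seat abc-iut-L1-t3) for the
operations of every Frobenioid `F : C → F_Φ` — abc-iut node `FrdI:Prop3.3(iv)` unconditionally — and
records the Frobenioid instance of (iii). No new definitions.
-/

namespace Literature.AlgebraicGeometry.Frobenioids

open CategoryTheory

universe w v v' u u'

namespace PreFrobenioid

variable {D : Type u} [Category.{v} D] {Φ : Dᵒᵖ ⥤ CommMonCat.{w}} {C : Type u'} [Category.{v'} C]
  {F : C ⥤ ElemFrobenioid Φ}

/-- **Proposition 3.3 (iv)** [FrdI p. 60] for a Frobenioid `F : C → F_Φ`, AS TYPED: `C^istr → F_Φ` factors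
through `C^un-tr` (unit-equivalent arrows have the same `(deg_Fr, Div, Base)`) and the induced
`C^un-tr → F_Φ` is faithful (arrows with the same invariants coincide in `C^un-tr`) — from Prop. 3.3 (ii)
(`FrdI.Prop33ii_holds`) by `prop33iv_of_prop33ii`. Discharges node `FrdI:Prop3.3(iv)`.
[cite: MochizukiFrdI2008, Prop. 3.3 (iv) p.60] -/
theorem prop33iv_holds (hF : IsFrobenioid F) : Prop33iv (PreFrobenioidData.ofFunctor Φ F) :=
  (PreFrobenioidData.ofFunctor Φ F).prop33iv_of_prop33ii (FrdI.Prop33ii_holds F hF)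

/-- **Proposition 3.3 (iii)** [FrdI p. 60] for a Frobenioid (instance of the every-`S` theorem
`PreFrobenioidData.prop33iii_holds`): `C^istr → C^un-tr` is an equivalence iff `C^istr` is of unit-trivial
type. [cite: MochizukiFrdI2008, Prop. 3.3 (iii) p.60] -/
theorem prop33iii_holds (F : C ⥤ ElemFrobenioid Φ) : Prop33iii (PreFrobenioidData.ofFunctor Φ F) :=
  (PreFrobenioidData.ofFunctor Φ F).prop33iii_holds

/-- Unit-equivalent arrows of `C^istr` have the same Frobenius degree, zero divisor and base projection
(necessity half of Prop. 3.3 (ii), for a Frobenioid). [cite: MochizukiFrdI2008, Prop. 3.3 (ii) p.59] -/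
theorem unitEquiv_invariants (hF : IsFrobenioid F) {A B : (PreFrobenioidData.ofFunctor Φ F).Istr}
    (α₁ α₂ : A ⟶ B) (e : (PreFrobenioidData.ofFunctor Φ F).UnitEquiv α₁ α₂) :
    degFr F α₁.hom = degFr F α₂.hom ∧ Div F α₁.hom = Div F α₂.hom ∧ Base F α₁.hom = Base F α₂.hom :=
  (prop33iv_holds hF).1 α₁ α₂ e

end PreFrobenioid

end Literature.AlgebraicGeometry.Frobenioids
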